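import Literature.AlgebraicGeometry.Resolution.GeneralLUProofs
import Literature.AlgebraicGeometry.Resolution.LUCompleteChar0TrustBase
import Literature.AlgebraicGeometry.Resolution.Temkin2008
import HarnessLib

/-!
# (LU) for complete local domains of dimension three: trust base after `Stacks07QU_holds`

Topic: `Literature/AlgebraicGeometry/Resolution` (proofs only; no new notions, no new named
facts). The named fact `CossartPiltant2019LUComplete3` (`ArithmeticalThreefolds.lean`) is
Cossart–Piltant's local uniformization statement (LU) (§4.1, arXiv v1 p. 50: "for every
valuation `v` of `K`, with valuation ring `(𝒪_v, m_v, k_v)` such that `A ⊂ 𝒪_v ⊂ K`,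
`m_v ∩ A = m`, `k_v | k` algebraic, there exists a finitely generated `A`-algebra `T`,
`A ⊆ T ⊆ 𝒪_v`, such that `T_P` is regular, where `P := m_v ∩ T`") for complete Noetherian local
domains of dimension three — the statement to which the proof of journal Prop. 4.10 (arXiv v1
Prop. 4.8, p. 53) reduces Thm. 1.1: "By proposition 4.8 [v1: 4.6], it is sufficient to prove that
(LU) holds for every complete local domain `(A, m, k)` of dimension three. … We may assume here
that `char k_v = p > 0`, the equicharacteristic zero version of theorem 1.1 being known."

The tree holds two PROVED assemblies of this fact from named facts:

* along the paper's own architecture (`ArithmeticalThreefoldsLocal.lean`),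
  `CossartPiltant2019LUComplete3.of_local : CossartPiltant2019Local → CossartPiltant2019ReductionP →
  CossartPiltant2019LUCompleteChar0 → CossartPiltant2019LUComplete3` (journal Thm. 1.5; the climb
  of the proof of Prop. 4.10 in residue characteristic `p`; the residue-characteristic-zero case);
* from Thm. 1.1 as printed (`GeneralLU.lean`), `CossartPiltant2019General.luComplete3 :
  CossartPiltant2019General → Stacks07QU → Stacks07QW_complete → CossartPiltant2019LUComplete3`.

Since those files were written, both excellence inputs have been PROVED in the tree:
`Stacks07QW_complete_holds` (complete Noetherian local rings are excellent, Stacks 07QW (2),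
`ExcellentRingsCompleteHolds.lean`) and `Stacks07QU_holds` (finite type algebras over
quasi-excellent rings are quasi-excellent, Stacks 07QU, resting on Grothendieck's 07PV,
`GeneralLUProofs.lean`); and the characteristic-zero leaf was re-rooted in the published
theorems it abbreviates (`luCompleteChar0_of_temkin2008`, `Temkin2008.lean`;
`CossartPiltant2019LUCompleteChar0.of_hironaka1964_local`, `LUCompleteChar0TrustBase.lean`).
This file records the resulting trust bases of `CossartPiltant2019LUComplete3`, each hypothesis
being an existing named fact of this topic and nothing else:

* `CossartPiltant2019LUCompleteChar0.of_temkin2008 : Temkin2008 → CossartPiltant2019LUCompleteChar0`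
  (the Temkin route of the characteristic-zero leaf with `Stacks07QU`, `Stacks07QW_complete`
  discharged; the Hironaka route is `.of_hironaka1964_local`);
* `CossartPiltant2019General.cpLocalUniformization_of_isAdicComplete` — (LU) for every complete
  Noetherian local domain of dimension `≤ 3` from Thm. 1.1 alone (what Cor. 1.2 gives along
  valuations);
* `CossartPiltant2019LUComplete3.of_general : CossartPiltant2019General → CossartPiltant2019LUComplete3`
  — trust base {Thm. 1.1 as printed};
* `CossartPiltant2019LUComplete3.of_local_hironaka1964`,
  `CossartPiltant2019LUComplete3.of_local_temkin2008` — trust base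
  {`CossartPiltant2019Local` (journal Thm. 1.5), `CossartPiltant2019ReductionP` (proof of
  Prop. 4.10), `Hironaka1964_local` resp. `Temkin2008`} along the paper's architecture.

So the discharge `CossartPiltant2019LUComplete3_holds` is ONE of the one-liners
`.of_general CossartPiltant2019General_holds`,
`.of_local_hironaka1964 CossartPiltant2019Local_holds CossartPiltant2019ReductionP_holds Hironaka1964_local_holds`,
`.of_local_temkin2008 CossartPiltant2019Local_holds CossartPiltant2019ReductionP_holds Temkin2008_holds`,
none of whose inputs is proved as of this file (the proof side of `CossartPiltant2019ReductionP`
is in progress: `ArithmeticalThreefoldsReduction.lean`, `ArithmeticalThreefoldsLocalTower.lean`,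
`ArithmeticalThreefoldsLocalInseparable.lean`, `ArithmeticalThreefoldsLocalGeneralStep.lean`).
Note that the first route is logically downstream of the fact in the paper itself (Thm. 1.1 is
PROVED from (LU) for complete local domains of dimension three, Props. 4.8, 4.10), so the
second/third are the ones along which a proof can actually arrive.

## Sources

* V. Cossart, O. Piltant, *Resolution of singularities of arithmetical threefolds*, J. Algebra
  529 (2019) 268–535 = arXiv:1412.0868: Thm. 1.1 and Cor. 1.2 (arXiv v1 p. 3), §4.1 (LU)
  (v1 p. 50), Prop. 4.8 (v1: Prop. 4.6, p. 52), proof of Prop. 4.10 (v1: Prop. 4.8, pp. 53–54),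
  Thm. 1.5 (v1: Thm. 1.4, p. 4). [CossartPiltant2019]
* M. Temkin, *Desingularization of quasi-excellent schemes in characteristic zero*, Adv. Math.
  219 (2008) 488–522, Thm. 1.1, Thm. 2.3.6. [Temkin2008]
* H. Hironaka, Ann. of Math. 79 (1964), Main Theorem I. [Hironaka1964]
* The Stacks Project, Tags 07QU, 07QW. [StacksProject]
-/

noncomputable section

open IsLocalRing

namespace Literature.AlgebraicGeometry.Resolution

universe u

/-! ## The characteristic-zero leaf, Temkin route, with the excellence inputs discharged -/

/-- **`Temkin2008 → CossartPiltant2019LUCompleteChar0`**: (LU) for complete Noetherian local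
domains of dimension three and residue characteristic zero rests, along the Temkin route
(`luCompleteChar0_of_temkin2008`), on the single leaf `Temkin2008` — `Stacks07QU`
(`Stacks07QU_holds`) and `Stacks07QW_complete` (`Stacks07QW_complete_holds`) being proved.
[cite: CossartPiltant2019, proof of Prop. 4.10 (arXiv v1: Prop. 4.8, p. 53), first paragraph]
[cite: Temkin2008, Thm. 1.1] -/
theorem CossartPiltant2019LUCompleteChar0.of_temkin2008 (hT : Temkin2008.{u}) :
    CossartPiltant2019LUCompleteChar0.{u} :=
  luCompleteChar0_of_temkin2008 hT Stacks07QU_holds Stacks07QW_complete_holds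

/-! ## From Thm. 1.1 as printed -/

/-- **(LU) for complete Noetherian local domains of dimension `≤ 3` from Thm. 1.1 alone**
(Cossart–Piltant 2019, Cor. 1.2 read along valuations: "Let `A` be a reduced complete
Noetherian local ring of dimension three. Then `𝒳 := Spec A` has a good resolution of
singularities"): a complete Noetherian local ring is excellent (`Stacks07QW_complete_holds`),
hence quasi-excellent, so `CossartPiltant2019General.cpLocalUniformization` applies with
`Stacks07QU_holds`. [cite: CossartPiltant2019, Thm. 1.1, Cor. 1.2 and §4.1 (LU)] -/
theorem CossartPiltant2019General.cpLocalUniformization_of_isAdicComplete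
    (h : CossartPiltant2019General.{u}) (A : Type u) [CommRing A] [IsDomain A] [IsLocalRing A]
    [IsNoetherianRing A] [IsAdicComplete (maximalIdeal A) A] (hdim : ringKrullDim A ≤ 3) :
    CPLocalUniformization A :=
  h.cpLocalUniformization Stacks07QU_holds A (Stacks07QW_complete_holds A).isQuasiExcellentRing hdim

/-- **`CossartPiltant2019General → CossartPiltant2019LUComplete3`**: with `Stacks07QU` and
`Stacks07QW_complete` proved, the assembly `CossartPiltant2019General.luComplete3` leaves the
single leaf Thm. 1.1 as printed. (In the paper the implication runs the other way round —
Thm. 1.1 is deduced from (LU) for complete local domains of dimension three, Props. 4.8 and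
4.10 — so this records a trust base, not a line of proof.)
[cite: CossartPiltant2019, Thm. 1.1, Cor. 1.2 and proof of Prop. 4.10 (arXiv v1: Prop. 4.8)] -/
theorem CossartPiltant2019LUComplete3.of_general (h : CossartPiltant2019General.{u}) :
    CossartPiltant2019LUComplete3.{u} :=
  h.luComplete3 Stacks07QU_holds Stacks07QW_complete_holds

/-! ## Along the paper's architecture (Thm. 1.5 ⇒ Prop. 4.10), characteristic-zero leaf re-rooted -/

/-- **Trust base along the paper's own proof, Hironaka route**: the local theorem
(`CossartPiltant2019Local`, journal Thm. 1.5 = arXiv v1 Thm. 1.4, weak form), the climb of the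
proof of Prop. 4.10 in residue characteristic `p > 0` (`CossartPiltant2019ReductionP`), and
Hironaka's theorem over local quasi-excellent rings of residue characteristic zero
(`Hironaka1964_local`, "the equicharacteristic zero version of theorem 1.1 being known") give
(LU) for complete local domains of dimension three; the excellence of complete local rings used
on the characteristic-zero side is proved (`Stacks07QW_complete_holds`).
[cite: CossartPiltant2019, proof of Prop. 4.10 (arXiv v1: Prop. 4.8, pp. 53–54)]
[cite: Hironaka1964, Main Theorem I] -/
theorem CossartPiltant2019LUComplete3.of_local_hironaka1964 (hloc : CossartPiltant2019Local.{u})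
    (hred : CossartPiltant2019ReductionP.{u}) (hH : Hironaka1964_local.{u}) :
    CossartPiltant2019LUComplete3.{u} :=
  CossartPiltant2019LUComplete3.of_local hloc hred
    (CossartPiltant2019LUCompleteChar0.of_hironaka1964_local hH)

/-- **Trust base along the paper's own proof, Temkin route**: as
`CossartPiltant2019LUComplete3.of_local_hironaka1964` with the characteristic-zero leaf taken
from Temkin's desingularization of quasi-excellent schemes of characteristic zero
(`Temkin2008`), the excellence inputs `Stacks07QU`, `Stacks07QW_complete` being proved.
[cite: CossartPiltant2019, proof of Prop. 4.10 (arXiv v1: Prop. 4.8, pp. 53–54)]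
[cite: Temkin2008, Thm. 1.1] -/
theorem CossartPiltant2019LUComplete3.of_local_temkin2008 (hloc : CossartPiltant2019Local.{u})
    (hred : CossartPiltant2019ReductionP.{u}) (hT : Temkin2008.{u}) :
    CossartPiltant2019LUComplete3.{u} :=
  CossartPiltant2019LUComplete3.of_local hloc hred
    (CossartPiltant2019LUCompleteChar0.of_temkin2008 hT)

end Literature.AlgebraicGeometry.Resolution

end
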